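import Summits.CriticalPhenomena.PercolationContinuityZ3.Theorems.PercNearOneGluingNoHeavyLowerTailRootedExchangeSlack
import HarnessLib

/-!
# `NoHeavyLowerTail` (stmt-CriticalPhenomena-4575) — the rooted kernel with slack: a quantitative (DC) bound under the glued champion,
# and the QUANTITATIVE CHAMPION-EDGE CRITERION

Support file (prover `prim-hp-3`, hull-port line; `--supports stmt-CriticalPhenomena-4575`).  No definitions, no named facts, no sorries.

Notation: `μ_w = prodBernoulli w`, relays `A`, level `j`, `I_w(x) = μ_w{|π(x)| ≤ j}`; observer set `O = {o, o'}` with `o` glued to a relay `t` (`w s(o,t) = 1`) and `o' ∉ A` a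
pendant star; E-mass `E_w(v)`; free room `F_w(v) = μ_w(v ↮ O, |π(t)| ≤ j < |π(O)|)`.

* `HullPort.obsE_add_free_le_of_glued_isolated`, `…_of_glued_both` — the two base cases with the free room (`F = 0` a.s. there).
* `HullPort.obsE_add_free_le_of_glued_seqSlack` — **rooted (DC) with slack.**  List `o'`'s ports `p₀, p₁, …` (`L ⊆ A` containing every positive-weight neighbour),
  `W 0 = w`, `W (l+1) = (W l)[s(o',p_l) ↦ 0]`, `c_l = (W l) s(o',p_l)`, `x_l = [I(p_l) − I(t)]⁺` in `(W l)[s(o',p_l) ↦ 1]`.  For ANY real sequence `T` with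
  `(1 − c_l)·T(l+1) + c_l·x_l ≤ T(l)` and `0 ≤ T(|L|)`:  `E_w(v) + F_w(v) ≤ I_w(t) + T(0)` for every `v ∈ A`.  (No domination hypothesis; with sequential domination
  all `x_l = 0` and `T ≡ 0` recovers `obsE_le_of_glued_seqDom`.)  One-bond decomposition at `s(o',p₀)` of all four measures (`real_update_affine`), glued face =
  `obsE_add_free_le_of_doublyGlued`, deleted face = induction.
* `HullPort.obsE_le_champion_of_quantRooted` — **quantitative champion-edge criterion**: `e = s(t,o₁)`, faces `w₀, w₁`; if `E_{w₀}(v) ≤ I_{w₀}(q)` ((DC) one pair down),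
  `E_{w₁}(v) + F_{w₁}(v) ≤ I_{w₁}(t) + Δ` (the rooted bound at the glued face) and `(w e)·(Δ − F_{w₁}(v)) ≤ (1 − w e)·(I_{w₀}(t) − I_{w₀}(q))`, then `E_w(v) ≤ I_w(t)`.
WHY (crux notes `HULLPORT-REF-gen6.md` §17): with `q` the (DC)-witness of the deleted face and `Δ = min over orders of Σ_l P(F_l) x_l`, the criterion
`c(Δ − F_1(v)) ≤ (1−c)(I_0(t) − E_0(v))` holds in EVERY pair of the seat census (incl. the 13 + 1 + 2 residual pairs of the qualitative criteria); its provable form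
(`E_0` replaced by the IH witness bound) closes all random/hub/glued designs and all but 9 jointcov-hard pairs, which need the exact deleted-face slack one level down.
-/

noncomputable section

namespace Summit.CriticalPhenomena.PercolationContinuityZ3.Theorems

open MeasureTheory Set Literature.Probability.LatticeModels Literature.Probability.Percolation
open scoped Classical BigOperators

variable {n : ℕ}

namespace HullPort

/-- **Glued observer, isolated second observer, with free room.**  `o ≠ t`, `w s(o,t) = 1`, all pairs at `o'` have weight `0`, `v ≠ o'`:
`E_w(v) + F_w(v) ≤ I_w(t)` for `O = {o, o'}`. [folklore] -/
theorem obsE_add_free_le_of_glued_isolated (w : Sym2 (Fin n) → unitInterval) (A : Finset (Fin n)) (o o' t v : Fin n) (j : ℕ)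
    (hot : o ≠ t) (ho'A : o' ∉ A) (hwt : w s(o, t) = 1) (hiso : ∀ u, w s(o', u) = 0) (hvo' : v ≠ o') :
    (prodBernoulli w).real {ω : BondConfig (Fin n) | (∀ x ∈ ({o, o'} : Finset (Fin n)), ω ∉ openConn v x) ∧
        1 ≤ (A.filter fun z => ∃ x ∈ ({o, o'} : Finset (Fin n)), ω ∈ openConn x z).card ∧
        (A.filter fun z => ∃ x ∈ ({o, o'} : Finset (Fin n)), ω ∈ openConn x z).card ≤ j} +
      (prodBernoulli w).real {ω : BondConfig (Fin n) | (∃ x ∈ ({o, o'} : Finset (Fin n)), ω ∈ openConn v x) ∧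
        (A.filter fun z => ω ∈ openConn v z).card ≤ j} +
      (prodBernoulli w).real {ω : BondConfig (Fin n) | (∀ x ∈ ({o, o'} : Finset (Fin n)), ω ∉ openConn v x) ∧
        (A.filter fun z => ω ∈ openConn t z).card ≤ j ∧
        j < (A.filter fun z => ∃ x ∈ ({o, o'} : Finset (Fin n)), ω ∈ openConn x z).card} ≤
      (prodBernoulli w).real {ω : BondConfig (Fin n) | (A.filter fun z => ω ∈ openConn t z).card ≤ j} := by
  set μ := prodBernoulli w with hμ
  set O : Finset (Fin n) := {o, o'} with hO
  set Fr := {ω : BondConfig (Fin n) | (∀ x ∈ O, ω ∉ openConn v x) ∧ (A.filter fun z => ω ∈ openConn t z).card ≤ j ∧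
        j < (A.filter fun z => ∃ x ∈ O, ω ∈ openConn x z).card} with hFr
  set G : Set (BondConfig (Fin n)) := {ω | s(o, t) ∈ ω} ∩ {ω | ∀ e ∈ ω, w e ≠ 0} with hG
  have hbase := obsE_le_of_glued_isolated w A o o' t v j hot hwt hiso hvo'
  -- the free room is null: on the good set `π(O) = π(t)`
  have hfull : μ.real Fr ≤ μ.real (Fr ∩ G) := by
    have h1 : μ.real (Fr ∩ {ω : BondConfig (Fin n) | ∀ e ∈ ω, w e ≠ 0}) = μ.real Fr := CutObserver.measureReal_inter_support w Fr
    have h2 := edgeSw_real_eq_of_sure w s(o, t) hwt (Fr ∩ {ω : BondConfig (Fin n) | ∀ e ∈ ω, w e ≠ 0}) (Fr ∩ G)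
      (fun ω he => by
        simp only [hG, mem_inter_iff, mem_setOf_eq]
        exact ⟨fun h => ⟨h.1, he, h.2⟩, fun h => ⟨h.1, h.2.2⟩⟩)
    rw [← h1, h2]
  have hiso' : ∀ ω ∈ G, ∀ z, (openGraph ω).Reachable o' z → z = o' := by
    intro ω hω z hz
    by_contra hne
    obtain ⟨wk⟩ := hz
    cases wk with
    | nil => exact hne rfl
    | @cons _ u _ hadj _ =>
      have h' := (openGraph_adj ω o' u).mp hadj
      exact hω.2 _ h'.1 (hiso u)
  have hempty : Fr ∩ G ⊆ (∅ : Set (BondConfig (Fin n))) := by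
    rintro ω ⟨⟨-, hle, hlt⟩, hg⟩
    have hot' : (openGraph ω).Reachable o t := ((openGraph_adj ω o t).mpr ⟨hg.1, hot⟩).reachable
    have hsub : (A.filter fun z => ∃ x ∈ O, ω ∈ openConn x z) ⊆ (A.filter fun z => ω ∈ openConn t z) := by
      intro z hz
      rw [Finset.mem_filter] at hz ⊢
      obtain ⟨hzA, x, hxO, hxz⟩ := hz
      refine ⟨hzA, ?_⟩
      simp only [hO, Finset.mem_insert, Finset.mem_singleton] at hxO
      rcases hxO with rfl | rfl
      · exact (hot'.symm.trans (show (openGraph ω).Reachable _ z from hxz) : (openGraph ω).Reachable t z)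
      · exfalso
        have hz' := hiso' ω hg z hxz
        subst hz'
        exact ho'A hzA
    exact absurd (lt_of_lt_of_le hlt ((Finset.card_le_card hsub).trans hle)) (lt_irrefl j)
  have h0 : μ.real (Fr ∩ G) ≤ 0 := by
    have := measureReal_mono hempty (measure_ne_top (μ := μ) _)
    simpa using this
  have hFr0 : μ.real Fr ≤ 0 := hfull.trans h0
  linarith [measureReal_nonneg (μ := μ) (s := Fr)]

/-- **Both observers glued to the same relay, with free room.**  `o ≠ t`, `o' ≠ t`, `w s(o,t) = 1`, `w s(o',t) = 1`: `E_w(v) + F_w(v) ≤ I_w(t)`. [folklore] -/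
theorem obsE_add_free_le_of_glued_both (w : Sym2 (Fin n) → unitInterval) (A : Finset (Fin n)) (o o' t v : Fin n) (j : ℕ)
    (hot : o ≠ t) (ho't : o' ≠ t) (hwt : w s(o, t) = 1) (hwt' : w s(o', t) = 1) :
    (prodBernoulli w).real {ω : BondConfig (Fin n) | (∀ x ∈ ({o, o'} : Finset (Fin n)), ω ∉ openConn v x) ∧
        1 ≤ (A.filter fun z => ∃ x ∈ ({o, o'} : Finset (Fin n)), ω ∈ openConn x z).card ∧
        (A.filter fun z => ∃ x ∈ ({o, o'} : Finset (Fin n)), ω ∈ openConn x z).card ≤ j} +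
      (prodBernoulli w).real {ω : BondConfig (Fin n) | (∃ x ∈ ({o, o'} : Finset (Fin n)), ω ∈ openConn v x) ∧
        (A.filter fun z => ω ∈ openConn v z).card ≤ j} +
      (prodBernoulli w).real {ω : BondConfig (Fin n) | (∀ x ∈ ({o, o'} : Finset (Fin n)), ω ∉ openConn v x) ∧
        (A.filter fun z => ω ∈ openConn t z).card ≤ j ∧
        j < (A.filter fun z => ∃ x ∈ ({o, o'} : Finset (Fin n)), ω ∈ openConn x z).card} ≤
      (prodBernoulli w).real {ω : BondConfig (Fin n) | (A.filter fun z => ω ∈ openConn t z).card ≤ j} := by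
  set μ := prodBernoulli w with hμ
  set O : Finset (Fin n) := {o, o'} with hO
  set Fr := {ω : BondConfig (Fin n) | (∀ x ∈ O, ω ∉ openConn v x) ∧ (A.filter fun z => ω ∈ openConn t z).card ≤ j ∧
        j < (A.filter fun z => ∃ x ∈ O, ω ∈ openConn x z).card} with hFr
  set G : Set (BondConfig (Fin n)) := {ω | s(o, t) ∈ ω} ∩ {ω | s(o', t) ∈ ω} with hG
  have hbase := obsE_le_of_glued_both w A o o' t v j hot ho't hwt hwt'
  have hfull : μ.real Fr ≤ μ.real (Fr ∩ G) := by
    have h1 := edgeSw_real_eq_of_sure w s(o, t) hwt Fr (Fr ∩ {ω : BondConfig (Fin n) | s(o, t) ∈ ω})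
      (fun ω he => by simp only [mem_inter_iff, mem_setOf_eq]; exact ⟨fun h => ⟨h, he⟩, fun h => h.1⟩)
    have h2 := edgeSw_real_eq_of_sure w s(o', t) hwt' (Fr ∩ {ω : BondConfig (Fin n) | s(o, t) ∈ ω}) (Fr ∩ G)
      (fun ω he => by
        simp only [hG, mem_inter_iff, mem_setOf_eq]
        exact ⟨fun h => ⟨h.1, h.2, he⟩, fun h => ⟨h.1, h.2.1⟩⟩)
    rw [h1, h2]
  have hempty : Fr ∩ G ⊆ (∅ : Set (BondConfig (Fin n))) := by
    rintro ω ⟨⟨-, hle, hlt⟩, hg⟩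
    have hreach : ∀ x ∈ O, (openGraph ω).Reachable x t := by
      intro x hx
      simp only [hO, Finset.mem_insert, Finset.mem_singleton] at hx
      rcases hx with rfl | rfl
      · exact ((openGraph_adj ω _ t).mpr ⟨hg.1, hot⟩).reachable
      · exact ((openGraph_adj ω _ t).mpr ⟨hg.2, ho't⟩).reachable
    have hsub : (A.filter fun z => ∃ x ∈ O, ω ∈ openConn x z) ⊆ (A.filter fun z => ω ∈ openConn t z) := by
      intro z hz
      rw [Finset.mem_filter] at hz ⊢
      obtain ⟨hzA, x, hxO, hxz⟩ := hz
      exact ⟨hzA, ((hreach x hxO).symm.trans (show (openGraph ω).Reachable x z from hxz) : (openGraph ω).Reachable t z)⟩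
    exact absurd (lt_of_lt_of_le hlt ((Finset.card_le_card hsub).trans hle)) (lt_irrefl j)
  have h0 : μ.real (Fr ∩ G) ≤ 0 := by
    have := measureReal_mono hempty (measure_ne_top (μ := μ) _)
    simpa using this
  have hFr0 : μ.real Fr ≤ 0 := hfull.trans h0
  linarith [measureReal_nonneg (μ := μ) (s := Fr)]

/-- **Rooted (DC) with slack.**  `o, o' ∉ A`, `o ≠ o'`, `t ∈ A`, `w s(o,t) = 1`; `L ⊆ A` a list containing every positive-weight neighbour of `o'`;
`W 0 = w`, `W (l+1) = (W l)[s(o',L[l]) ↦ 0]`; `T` any real sequence with `0 ≤ T |L|` and, for every `l < |L|` (writing `c = (W l) s(o',L[l])`, `W₁ = (W l)[s(o',L[l]) ↦ 1]`),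
`(1 − c)·T(l+1) + c·max 0 (I_{W₁}(L[l]) − I_{W₁}(t)) ≤ T l`.  Then `E_w(v) + F_w(v) ≤ I_w(t) + T 0` for every `v ∈ A`.
[cite: VandenbergHaggstromKahn2005, Thm. 1.5 (p. 7) — via `obsE_add_free_le_of_doublyGlued`; this work] -/
theorem obsE_add_free_le_of_glued_seqSlack (A : Finset (Fin n)) (o o' t : Fin n) (j : ℕ)
    (hoA : o ∉ A) (ho'A : o' ∉ A) (hoo' : o ≠ o') (htA : t ∈ A) :
    ∀ (L : List (Fin n)) (w : Sym2 (Fin n) → unitInterval) (W : ℕ → (Sym2 (Fin n) → unitInterval)) (T : ℕ → ℝ),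
      w s(o, t) = 1 → (∀ u, w s(o', u) ≠ 0 → u ∈ L) → (∀ u ∈ L, u ∈ A) →
      W 0 = w → (∀ l, l < L.length → ∀ (hl : l < L.length), W (l + 1) = Function.update (W l) s(o', L[l]) 0) →
      0 ≤ T L.length →
      (∀ l, ∀ (hl : l < L.length),
        (1 - ((W l) s(o', L[l]) : ℝ)) * T (l + 1) +
          ((W l) s(o', L[l]) : ℝ) * max 0
            ((prodBernoulli (Function.update (W l) s(o', L[l]) 1)).real
                {ω : BondConfig (Fin n) | (A.filter fun z => ω ∈ openConn L[l] z).card ≤ j} -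
              (prodBernoulli (Function.update (W l) s(o', L[l]) 1)).real
                {ω : BondConfig (Fin n) | (A.filter fun z => ω ∈ openConn t z).card ≤ j}) ≤ T l) →
      ∀ v ∈ A,
        (prodBernoulli w).real {ω : BondConfig (Fin n) | (∀ x ∈ ({o, o'} : Finset (Fin n)), ω ∉ openConn v x) ∧
            1 ≤ (A.filter fun z => ∃ x ∈ ({o, o'} : Finset (Fin n)), ω ∈ openConn x z).card ∧
            (A.filter fun z => ∃ x ∈ ({o, o'} : Finset (Fin n)), ω ∈ openConn x z).card ≤ j} +
          (prodBernoulli w).real {ω : BondConfig (Fin n) | (∃ x ∈ ({o, o'} : Finset (Fin n)), ω ∈ openConn v x) ∧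
            (A.filter fun z => ω ∈ openConn v z).card ≤ j} +
          (prodBernoulli w).real {ω : BondConfig (Fin n) | (∀ x ∈ ({o, o'} : Finset (Fin n)), ω ∉ openConn v x) ∧
            (A.filter fun z => ω ∈ openConn t z).card ≤ j ∧
            j < (A.filter fun z => ∃ x ∈ ({o, o'} : Finset (Fin n)), ω ∈ openConn x z).card} ≤
        (prodBernoulli w).real {ω : BondConfig (Fin n) | (A.filter fun z => ω ∈ openConn t z).card ≤ j} + T 0 := by
  have hot : o ≠ t := fun h => hoA (h ▸ htA)
  have ho't : o' ≠ t := fun h => ho'A (h ▸ htA)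
  intro L
  induction L with
  | nil =>
    intro w W T hwt hcover _ _ _ hT0 _ v hvA
    have hiso : ∀ u, w s(o', u) = 0 := by
      intro u
      by_contra h
      exact (List.not_mem_nil (hcover u h))
    have hvo' : v ≠ o' := fun h => ho'A (h ▸ hvA)
    have h := obsE_add_free_le_of_glued_isolated w A o o' t v j hot ho'A hwt hiso hvo'
    have hT : 0 ≤ T 0 := by simpa using hT0
    linarith
  | cons p L' ih =>
    intro w W T hwt hcover hLA hW0 hWs hTend hT v hvA
    have hpA : p ∈ A := hLA p (by simp)
    have hpo' : p ≠ o' := fun h => ho'A (h ▸ hpA)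
    have hop : o ≠ p := fun h => hoA (h ▸ hpA)
    set e : Sym2 (Fin n) := s(o', p) with he
    have hne : s(o, t) ≠ e := by
      rw [he, Ne, Sym2.eq_iff]
      push Not
      exact ⟨fun h => absurd h hoo', fun h => absurd h hop⟩
    set w₀ := Function.update w e 0 with hw₀
    set w₁ := Function.update w e 1 with hw₁
    have hw₀t : w₀ s(o, t) = 1 := by rw [hw₀, Function.update_of_ne hne]; exact hwt
    have hw₁t : w₁ s(o, t) = 1 := by rw [hw₁, Function.update_of_ne hne]; exact hwt
    -- abbreviations for the four measures as functions of the weight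
    set EA : (Sym2 (Fin n) → unitInterval) → ℝ := fun u =>
      (prodBernoulli u).real {ω : BondConfig (Fin n) | (∀ x ∈ ({o, o'} : Finset (Fin n)), ω ∉ openConn v x) ∧
          1 ≤ (A.filter fun z => ∃ x ∈ ({o, o'} : Finset (Fin n)), ω ∈ openConn x z).card ∧
          (A.filter fun z => ∃ x ∈ ({o, o'} : Finset (Fin n)), ω ∈ openConn x z).card ≤ j} with hEA
    set EB : (Sym2 (Fin n) → unitInterval) → ℝ := fun u =>
      (prodBernoulli u).real {ω : BondConfig (Fin n) | (∃ x ∈ ({o, o'} : Finset (Fin n)), ω ∈ openConn v x) ∧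
          (A.filter fun z => ω ∈ openConn v z).card ≤ j} with hEB
    set FR : (Sym2 (Fin n) → unitInterval) → ℝ := fun u =>
      (prodBernoulli u).real {ω : BondConfig (Fin n) | (∀ x ∈ ({o, o'} : Finset (Fin n)), ω ∉ openConn v x) ∧
          (A.filter fun z => ω ∈ openConn t z).card ≤ j ∧
          j < (A.filter fun z => ∃ x ∈ ({o, o'} : Finset (Fin n)), ω ∈ openConn x z).card} with hFR
    set IT : (Sym2 (Fin n) → unitInterval) → ℝ := fun u =>
      (prodBernoulli u).real {ω : BondConfig (Fin n) | (A.filter fun z => ω ∈ openConn t z).card ≤ j} with hIT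
    set IP : (Sym2 (Fin n) → unitInterval) → ℝ := fun u =>
      (prodBernoulli u).real {ω : BondConfig (Fin n) | (A.filter fun z => ω ∈ openConn p z).card ≤ j} with hIP
    -- glued face
    have h1 : EA w₁ + EB w₁ + FR w₁ ≤ IT w₁ + max 0 (IP w₁ - IT w₁) := by
      by_cases hpt : p = t
      · have hw₁' : w₁ s(o', t) = 1 := by rw [hw₁, he, hpt]; simp
        have h := obsE_add_free_le_of_glued_both w₁ A o o' t v j hot ho't hw₁t hw₁'
        have hm : 0 ≤ max 0 (IP w₁ - IT w₁) := le_max_left _ _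
        simp only [hEA, hEB, hFR, hIT] at h ⊢
        linarith
      · have hw₁p : w₁ s(o', p) = 1 := by rw [hw₁, he]; simp
        exact obsE_add_free_le_of_doublyGlued w₁ A o o' p t v j hot (Ne.symm hpo') hpt hw₁t hw₁p
    -- deleted face: induction hypothesis with shifted `W`, `T`
    have h0 : EA w₀ + EB w₀ + FR w₀ ≤ IT w₀ + T 1 := by
      have hW1 : W 1 = w₀ := by
        have h := hWs 0 (by simp) (by simp)
        simp only [List.getElem_cons_zero, zero_add] at h
        rw [h, hW0]
      refine ih w₀ (fun l => W (l + 1)) (fun l => T (l + 1)) hw₀t ?_ (fun u hu => hLA u (List.mem_cons_of_mem p hu)) hW1 ?_ ?_ ?_ v hvA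
      · intro u hu
        by_cases hup : u = p
        · exact absurd (by rw [hup, hw₀, he]; simp) hu
        · have : w s(o', u) ≠ 0 := by
            have hne' : s(o', u) ≠ e := by
              rw [he, Ne, Sym2.eq_iff]; push Not
              exact ⟨fun _ => hup, fun h => absurd h.symm hpo'⟩
            rwa [hw₀, Function.update_of_ne hne'] at hu
          have hmem := hcover u this
          rcases List.mem_cons.mp hmem with h | h
          · exact absurd h hup
          · exact h
      · intro l hl hl'
        have h := hWs (l + 1) (by simp; omega) (by simp; omega)
        simp only [List.getElem_cons_succ] at h
        exact h
      · simpa using hTend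
      · intro l hl
        have h := hT (l + 1) (by simp; omega)
        simp only [List.getElem_cons_succ] at h
        exact h
    -- the slack budget at `l = 0`
    have hT0 := hT 0 (by simp)
    simp only [List.getElem_cons_zero] at hT0
    rw [hW0] at hT0
    -- one-bond decomposition of the four measures at `e`
    have hwe : Function.update w e (w e) = w := Function.update_eq_self e w
    have dA := real_update_affine w e (w e) {ω : BondConfig (Fin n) | (∀ x ∈ ({o, o'} : Finset (Fin n)), ω ∉ openConn v x) ∧
          1 ≤ (A.filter fun z => ∃ x ∈ ({o, o'} : Finset (Fin n)), ω ∈ openConn x z).card ∧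
          (A.filter fun z => ∃ x ∈ ({o, o'} : Finset (Fin n)), ω ∈ openConn x z).card ≤ j}
    have dB := real_update_affine w e (w e) {ω : BondConfig (Fin n) | (∃ x ∈ ({o, o'} : Finset (Fin n)), ω ∈ openConn v x) ∧
          (A.filter fun z => ω ∈ openConn v z).card ≤ j}
    have dF := real_update_affine w e (w e) {ω : BondConfig (Fin n) | (∀ x ∈ ({o, o'} : Finset (Fin n)), ω ∉ openConn v x) ∧
          (A.filter fun z => ω ∈ openConn t z).card ≤ j ∧
          j < (A.filter fun z => ∃ x ∈ ({o, o'} : Finset (Fin n)), ω ∈ openConn x z).card}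
    have dT := real_update_affine w e (w e) {ω : BondConfig (Fin n) | (A.filter fun z => ω ∈ openConn t z).card ≤ j}
    rw [hwe] at dA dB dF dT
    rw [← hw₀, ← hw₁] at dA dB dF dT
    change EA w = (1 - (w e : ℝ)) * EA w₀ + (w e : ℝ) * EA w₁ at dA
    change EB w = (1 - (w e : ℝ)) * EB w₀ + (w e : ℝ) * EB w₁ at dB
    change FR w = (1 - (w e : ℝ)) * FR w₀ + (w e : ℝ) * FR w₁ at dF
    change IT w = (1 - (w e : ℝ)) * IT w₀ + (w e : ℝ) * IT w₁ at dT
    have hc0 : 0 ≤ (w e : ℝ) := (w e).2.1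
    have hc1 : 0 ≤ 1 - (w e : ℝ) := by linarith [(w e).2.2]
    change EA w + EB w + FR w ≤ IT w + T 0
    rw [dA, dB, dF, dT]
    have hT0' : (1 - (w e : ℝ)) * T 1 + (w e : ℝ) * max 0 (IP w₁ - IT w₁) ≤ T 0 := by
      have : (w s(o', p) : ℝ) = (w e : ℝ) := by rw [he]
      rw [this] at hT0
      exact hT0
    nlinarith [mul_le_mul_of_nonneg_left h1 hc0, mul_le_mul_of_nonneg_left h0 hc1, hT0']

/-- **Quantitative champion-edge criterion.**  `e = s(t,o₁)`, `w₀ = w[e↦0]`, `w₁ = w[e↦1]`.  If `E_{w₀}(v) ≤ I_{w₀}(q)` ((DC) for `v` one pair down, witness `q`),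
`E_{w₁}(v) + F_{w₁}(v) ≤ I_{w₁}(t) + Δ` (the rooted bound with slack at the glued face), and `(w e)·(Δ − F_{w₁}(v)) ≤ (1 − w e)·(I_{w₀}(t) − I_{w₀}(q))`, then
`E_w(v) ≤ I_w(t)`.  [cite: VandenbergHaggstromKahn2005, Thm. 1.5 (p. 7) — bookkeeping over `real_update_affine`; this work] -/
theorem obsE_le_champion_of_quantRooted (w : Sym2 (Fin n) → unitInterval) (A : Finset (Fin n)) (o₁ o₂ t v q : Fin n) (j : ℕ) (Δ : ℝ)
    (h0 : (prodBernoulli (Function.update w s(t, o₁) 0)).real {ω : BondConfig (Fin n) | (∀ x ∈ ({o₁, o₂} : Finset (Fin n)), ω ∉ openConn v x) ∧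
          1 ≤ (A.filter fun z => ∃ x ∈ ({o₁, o₂} : Finset (Fin n)), ω ∈ openConn x z).card ∧
          (A.filter fun z => ∃ x ∈ ({o₁, o₂} : Finset (Fin n)), ω ∈ openConn x z).card ≤ j} +
        (prodBernoulli (Function.update w s(t, o₁) 0)).real {ω : BondConfig (Fin n) | (∃ x ∈ ({o₁, o₂} : Finset (Fin n)), ω ∈ openConn v x) ∧
          (A.filter fun z => ω ∈ openConn v z).card ≤ j} ≤
        (prodBernoulli (Function.update w s(t, o₁) 0)).real
          {ω : BondConfig (Fin n) | (A.filter fun z => ω ∈ openConn q z).card ≤ j})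
    (h1 : (prodBernoulli (Function.update w s(t, o₁) 1)).real {ω : BondConfig (Fin n) | (∀ x ∈ ({o₁, o₂} : Finset (Fin n)), ω ∉ openConn v x) ∧
          1 ≤ (A.filter fun z => ∃ x ∈ ({o₁, o₂} : Finset (Fin n)), ω ∈ openConn x z).card ∧
          (A.filter fun z => ∃ x ∈ ({o₁, o₂} : Finset (Fin n)), ω ∈ openConn x z).card ≤ j} +
        (prodBernoulli (Function.update w s(t, o₁) 1)).real {ω : BondConfig (Fin n) | (∃ x ∈ ({o₁, o₂} : Finset (Fin n)), ω ∈ openConn v x) ∧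
          (A.filter fun z => ω ∈ openConn v z).card ≤ j} +
        (prodBernoulli (Function.update w s(t, o₁) 1)).real {ω : BondConfig (Fin n) | (∀ x ∈ ({o₁, o₂} : Finset (Fin n)), ω ∉ openConn v x) ∧
          (A.filter fun z => ω ∈ openConn t z).card ≤ j ∧
          j < (A.filter fun z => ∃ x ∈ ({o₁, o₂} : Finset (Fin n)), ω ∈ openConn x z).card} ≤
        (prodBernoulli (Function.update w s(t, o₁) 1)).real {ω : BondConfig (Fin n) | (A.filter fun z => ω ∈ openConn t z).card ≤ j} + Δ)
    (hq : (w s(t, o₁) : ℝ) * (Δ - (prodBernoulli (Function.update w s(t, o₁) 1)).real {ω : BondConfig (Fin n) |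
          (∀ x ∈ ({o₁, o₂} : Finset (Fin n)), ω ∉ openConn v x) ∧ (A.filter fun z => ω ∈ openConn t z).card ≤ j ∧
          j < (A.filter fun z => ∃ x ∈ ({o₁, o₂} : Finset (Fin n)), ω ∈ openConn x z).card}) ≤
        (1 - (w s(t, o₁) : ℝ)) * ((prodBernoulli (Function.update w s(t, o₁) 0)).real
            {ω : BondConfig (Fin n) | (A.filter fun z => ω ∈ openConn t z).card ≤ j} -
          (prodBernoulli (Function.update w s(t, o₁) 0)).real {ω : BondConfig (Fin n) | (A.filter fun z => ω ∈ openConn q z).card ≤ j})) :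
    (prodBernoulli w).real {ω : BondConfig (Fin n) | (∀ x ∈ ({o₁, o₂} : Finset (Fin n)), ω ∉ openConn v x) ∧
        1 ≤ (A.filter fun z => ∃ x ∈ ({o₁, o₂} : Finset (Fin n)), ω ∈ openConn x z).card ∧
        (A.filter fun z => ∃ x ∈ ({o₁, o₂} : Finset (Fin n)), ω ∈ openConn x z).card ≤ j} +
      (prodBernoulli w).real {ω : BondConfig (Fin n) | (∃ x ∈ ({o₁, o₂} : Finset (Fin n)), ω ∈ openConn v x) ∧
        (A.filter fun z => ω ∈ openConn v z).card ≤ j} ≤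
      (prodBernoulli w).real {ω : BondConfig (Fin n) | (A.filter fun z => ω ∈ openConn t z).card ≤ j} := by
  set e : Sym2 (Fin n) := s(t, o₁) with he
  have hwe : Function.update w e (w e) = w := Function.update_eq_self e w
  have dA := real_update_affine w e (w e) {ω : BondConfig (Fin n) | (∀ x ∈ ({o₁, o₂} : Finset (Fin n)), ω ∉ openConn v x) ∧
        1 ≤ (A.filter fun z => ∃ x ∈ ({o₁, o₂} : Finset (Fin n)), ω ∈ openConn x z).card ∧
        (A.filter fun z => ∃ x ∈ ({o₁, o₂} : Finset (Fin n)), ω ∈ openConn x z).card ≤ j}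
  have dB := real_update_affine w e (w e) {ω : BondConfig (Fin n) | (∃ x ∈ ({o₁, o₂} : Finset (Fin n)), ω ∈ openConn v x) ∧
        (A.filter fun z => ω ∈ openConn v z).card ≤ j}
  have dT := real_update_affine w e (w e) {ω : BondConfig (Fin n) | (A.filter fun z => ω ∈ openConn t z).card ≤ j}
  rw [hwe] at dA dB dT
  rw [dA, dB, dT]
  have hc0 : 0 ≤ (w e : ℝ) := (w e).2.1
  have hc1 : 0 ≤ 1 - (w e : ℝ) := by linarith [(w e).2.2]
  have hF0 : 0 ≤ (prodBernoulli (Function.update w e 1)).real {ω : BondConfig (Fin n) |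
      (∀ x ∈ ({o₁, o₂} : Finset (Fin n)), ω ∉ openConn v x) ∧ (A.filter fun z => ω ∈ openConn t z).card ≤ j ∧
      j < (A.filter fun z => ∃ x ∈ ({o₁, o₂} : Finset (Fin n)), ω ∈ openConn x z).card} := measureReal_nonneg
  nlinarith [mul_le_mul_of_nonneg_left h1 hc0, mul_le_mul_of_nonneg_left h0 hc1, hq]

end HullPort

end Summit.CriticalPhenomena.PercolationContinuityZ3.Theorems

end
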